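import Literature.AnabelianGeometry.EtaleTheta.Discharge.Sec5Thm57Kummer
import Literature.AnabelianGeometry.EtaleTheta.Discharge.Sec5Thm57Tower

/-!
# [EtTh] §5, Theorem 5.7 — the `(O_K^×)^{1/N}`-half of the rigidity clause DISCHARGED at every level (pp. 329–331 / PDF pp. 103–105)

Mochizuki, *The étale theta function …*, Publ. RIMS **45** (2009)
[cite: MochizukiEtTh2009, Thm 5.7 p.330 (PDF p.104); Lem 5.8 p.331 (PDF p.105)].  Seat abc-iut-L2-d4 (node
`EtTh:Thm5.7`; rows T3 → T6 of abc-iut-L2-t4's THM57-TOWER-PLAN.md); PROOF-ONLY over this seat's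
`Discharge/Sec5Thm57Kummer.lean` (T3: `psiAut_biKummerDiff`), `Sec5Thm57.lean`, `Sec5Thm57Tower.lean` and
abc-iut-L2-t4's `FrobenioidMonoTheta.lean` (Lemma 5.8: `ConstantsActByCyclotome`, the `Facts` bundle).

Recall (`Sec5Thm57.lean`): Theorem 5.7 at the `N`-th root is discharged modulo the single binder `hrig` — the unit
discrepancy `u := D_c⁻¹ · D_p ∈ O^×(B_N)` of the transported root lies in `μ_{2l·N}(B_N) ∩ (O_K^×)^{1/N}` ("up to
possible multiplication by a `2l`-th root of unity", p.330 (PDF p.104)).  This file DISCHARGES the second half: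

(1) **`u` acts on `H_{B_N}` through the cyclotome `μ_N(B_N)`** (`kummerCocycle_mem_muTorsion_of_transport`): by T3
(`psiAut_biKummerDiff`) the transported bi-Kummer difference cocycle is `D_c · (d_N ∘ θ) · κ_u ∘ θ · D_c⁻¹` with
`κ_u(h) = s^⊔-gp_N(h) · u · s^⊔-gp_N(h)⁻¹ · u⁻¹`; both difference cocycles are `μ_N(B_N)`-valued (Prop. 4.3 (iii) —
abc-iut-L2-t4's `BiKummerDifferenceMem`, "the Kummer classes of Proposition 5.2, (iii)" of the printed proof),
`Ψ^Aut(μ_N(B_N)) = μ_N(B_N)` ("`Ψ` preserves `O^×(−)`", Thm. 4.4 (i)) and `μ_N(B_N)` is normal; hence `κ_u` is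
`μ_N(B_N)`-valued on `H_{B_N} = Im(Π^tp_Ÿ̲)` — "the Kummer class of the 'constant function' `u`" (proof of Thm. 5.6,
p.329) is a genuine `μ_N`-class; the same through `s^⊓-gp_N` (`kummerCocycleCap_mem_muTorsion_of_transport`).
(2) **Hence `u ∈ (O_K^×)^{1/N}`** (`discrepancy_mem_OKxRootN`) by Lemma 5.8 BY NAME (`ConstantsActByCyclotome`:
"the set of elements [of `O^×(B_N)`] on which `Π^tp_Y` [i.e., `G_K`, via the natural surjection `Π^tp_Y ↠ G_K`]
acts via multiplication by an element of `μ_N(B_N)` … coincide[s] with `(O_K^×)^{1/N}`", p.331 (PDF p.105)).  The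
typed fact quantifies over `Im(Π^tp_Y̲)`, the `s^⊔`-side transport only over `H_{B_N} = Im(Π^tp_Ÿ̲)` (index 2); the
bridge is print's parenthesis: the action on the constants factors through `G_K`, onto which `Π^tp_Ÿ̲` also surjects
(`Ÿ` geometrically connected over `K = K̈`, §5 p.322 (PDF p.96)) — carried as the explicit HYPOTHESIS BINDER `hfac`
(D-0067 (1): no new `Prop` definition; a GAP-LEDGER row names the wanted instance for the genuine data).
(3) **What is left of `hrig` is the TORSION half alone** (`rootTransportWith_of_torsion`, `exists_…`,
`thm510_ii_iii_of_torsion`, `ThetaFrobenioidTower.thetaRootPreservedAll_of_torsion`): `u^{2l·N} = 1`, equivalently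
(`pow_eq_one_of_const_pow`) "the constant `c ∈ K^×` with `u^N = c` is a `2l`-th root of unity" — the discrete content
of Theorem 5.7 that Remark 5.7.1 (p.330) singles out, i.e. exactly what the printed proof gets from "the rigidity of
the étale theta function [cf. Corollary 2.8, (i)]" over "compatible systems as in Remark 4.3.2" (rows T4/T5; the
compatible system itself is this seat's `ThetaFrobenioidTower.discrepancy_comp_beta_of_transports`).
HONEST FRAMING: kernel-checked implications between typed statements about the §5 data under named hypotheses;
nothing of [EtTh] is asserted unconditionally; typed ≠ discharged; no side taken on anything downstream. -/

namespace Literature.AnabelianGeometry.EtaleTheta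

open CategoryTheory
open Literature.AlgebraicGeometry.Frobenioids

universe w v v' u u'

namespace ThetaFrobenioid

variable {C : Type u} [Category.{v} C] {D : Type u'} [Category.{v'} D] {𝔉 : ThetaFrobenioid.{w} C D}

section PsiAutTorsion

variable (Ψ : C ≌ C) (β : Ψ.functor.obj 𝔉.BN ≅ 𝔉.BN)

/-- `Ψ^Aut(x) ∈ μ_M(B_N) ↔ x ∈ μ_M(B_N)` for every `M`, from `Ψ^Aut(O^×(B_N)) = O^×(B_N)` ("`Ψ` preserves `O^×(−)`",
proof of Thm. 5.6 p.328 (PDF p.102); Thm. 5.10 (ii) p.334 (PDF p.108)): `μ_M` is the `M`-torsion of `O^×`.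
[cite: MochizukiEtTh2009, Thm 5.10 (ii) p.334 (PDF p.108)] -/
theorem psiAut_mem_muTorsion_iff (hU : (𝔉.units 𝔉.BN).map (𝔉.psiAut Ψ β) = 𝔉.units 𝔉.BN) (M : ℕ)
    (x : Aut 𝔉.BN) : 𝔉.psiAut Ψ β x ∈ 𝔉.muTorsion 𝔉.BN M ↔ x ∈ 𝔉.muTorsion 𝔉.BN M := by
  rw [← psiAutEquiv_toMonoidHom] at hU
  rw [← psiAutEquiv_apply, mem_muTorsion, mem_muTorsion, mem_iff_of_map_equiv_eq hU, ← map_pow,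
    MulEquiv.map_eq_one_iff]

end PsiAutTorsion

/-! ### (1) The Kummer cocycle of the unit discrepancy is `μ_N(B_N)`-valued on `H_{B_N}` -/

section KummerCocycle

variable (Ψ : C ≌ C) (α : Ψ.functor.obj 𝔉.AN ≅ 𝔉.AN) (β : Ψ.functor.obj 𝔉.BN ≅ 𝔉.BN) (e : 𝔉.AN ≅ 𝔉.AN)
  (Dc Dp : Aut 𝔉.BN) (θ : Aut (𝔉.base.obj 𝔉.BN) ≃* Aut (𝔉.base.obj 𝔉.BN))

/-- In any group, `a = Dc·(X·κ)·Dc⁻¹` gives `κ = X⁻¹·(Dc⁻¹·a·Dc)`. [cite: MochizukiEtTh2009, Thm 5.7 p.330 (PDF p.104)] -/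
theorem eq_inv_mul_conj_of_eq_conj_mul {G : Type*} [Group G] {a Dc X κ : G} (h : a = Dc * (X * κ) * Dc⁻¹) :
    κ = X⁻¹ * (Dc⁻¹ * a * Dc) := by
  rw [h]; group

/-- **The Kummer cocycle of `u := D_c⁻¹ · D_p` is `μ_N(B_N)`-valued — at `θ h`.**  Under the root transport
(`hT`, `hT'`), the transport of `s^trv_N` through `e` over `θ` (`hstrv` = `StrvTransport`, Thm. 4.4 (iv)), the
defining relations `SgpCapSpec`/`SgpCupSpec` (p.331), `θ(H_{B_N}) = H_{B_N}` (Prop. 2.4), Prop. 4.3 (iii)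
(`BiKummerDifferenceMem`: the difference cocycle is `μ_N(B_N)`-valued) and `Ψ^Aut(O^×(B_N)) = O^×(B_N)`: for every
`h ∈ H_{B_N}`, `s^⊔-gp_N(θh) · u · s^⊔-gp_N(θh)⁻¹ · u⁻¹ ∈ μ_N(B_N)` — from T3 (`psiAut_biKummerDiff`):
`Ψ^Aut(d(h)) = D_c · (d(θh) · κ_u(θh)) · D_c⁻¹` with `d`, `Ψ^Aut(d)`, `d ∘ θ ∈ μ_N(B_N)` normal in `Aut_C(B_N)`.
[cite: MochizukiEtTh2009, Thm 5.7 p.330 (PDF p.104); Prop 4.3 (iii) p.317 (PDF p.91); Thm 5.6 proof p.329 (PDF p.103)] -/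
theorem kummerCocycle_theta_mem_muTorsion [Epi 𝔉.sCap] [Epi 𝔉.sCup] (hcap : 𝔉.SgpCapSpec)
    (hcup : 𝔉.SgpCupSpec) (hdiff : 𝔉.BiKummerDifferenceMem)
    (hU : (𝔉.units 𝔉.BN).map (𝔉.psiAut Ψ β) = 𝔉.units 𝔉.BN)
    (hT : α.inv ≫ Ψ.functor.map 𝔉.sCap ≫ β.hom = e.hom ≫ 𝔉.sCap ≫ Dc.hom)
    (hT' : α.inv ≫ Ψ.functor.map 𝔉.sCup ≫ β.hom = e.hom ≫ 𝔉.sCup ≫ Dp.hom)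
    (hstrv : ∀ g : Aut (𝔉.base.obj 𝔉.BN),
      α.inv ≫ Ψ.functor.map (𝔉.strv (𝔉.autBaseIsoAB.symm g)).hom ≫ α.hom ≫ e.hom =
        e.hom ≫ (𝔉.strv (𝔉.autBaseIsoAB.symm (θ g))).hom)
    (hYdd : 𝔉.HB.map θ.toMonoidHom = 𝔉.HB) (h : 𝔉.HB) :
    𝔉.sgpCup ⟨θ h, (mem_iff_of_map_equiv_eq hYdd _).mpr h.2⟩ * (Dc⁻¹ * Dp) *
        (𝔉.sgpCup ⟨θ h, (mem_iff_of_map_equiv_eq hYdd _).mpr h.2⟩)⁻¹ * (Dc⁻¹ * Dp)⁻¹ ∈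
      𝔉.muTorsion 𝔉.BN 𝔉.N := by
  haveI := 𝔉.muTorsion_normal 𝔉.BN 𝔉.N
  have key := psiAut_biKummerDiff Ψ α β e Dc Dp θ hcap hcup hT hT' hstrv hYdd h
  rw [eq_inv_mul_conj_of_eq_conj_mul key]
  refine mul_mem (inv_mem ?_) ((𝔉.muTorsion_normal 𝔉.BN 𝔉.N).conj_mem' _ ?_ Dc)
  · exact (𝔉.biKummerDifferenceMem_iff.mp hdiff) ⟨θ h, (mem_iff_of_map_equiv_eq hYdd _).mpr h.2⟩
  · exact (psiAut_mem_muTorsion_iff Ψ β hU 𝔉.N _).mpr ((𝔉.biKummerDifferenceMem_iff.mp hdiff) h)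

/-- **The Kummer cocycle of the unit discrepancy `u := D_c⁻¹ · D_p` is `μ_N(B_N)`-valued on `H_{B_N}`**: for every
`h ∈ H_{B_N}`, `κ_u(h) = s^⊔-gp_N(h) · u · s^⊔-gp_N(h)⁻¹ · u⁻¹ ∈ μ_N(B_N)` — i.e. `H_{B_N} = Im(Π^tp_Ÿ̲)` acts on the
constant `u` "via multiplication by an element of `μ_N(B_N)`" (the phrase of Lemma 5.8's proof, p.331 (PDF p.105)).
Inputs as in `kummerCocycle_theta_mem_muTorsion` (apply it at `θ⁻¹ h`).
[cite: MochizukiEtTh2009, Thm 5.7 p.330 (PDF p.104); Lem 5.8 proof p.331 (PDF p.105)] -/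
theorem kummerCocycle_mem_muTorsion_of_transport [Epi 𝔉.sCap] [Epi 𝔉.sCup] (hcap : 𝔉.SgpCapSpec)
    (hcup : 𝔉.SgpCupSpec) (hdiff : 𝔉.BiKummerDifferenceMem)
    (hU : (𝔉.units 𝔉.BN).map (𝔉.psiAut Ψ β) = 𝔉.units 𝔉.BN)
    (hT : α.inv ≫ Ψ.functor.map 𝔉.sCap ≫ β.hom = e.hom ≫ 𝔉.sCap ≫ Dc.hom)
    (hT' : α.inv ≫ Ψ.functor.map 𝔉.sCup ≫ β.hom = e.hom ≫ 𝔉.sCup ≫ Dp.hom)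
    (hstrv : ∀ g : Aut (𝔉.base.obj 𝔉.BN),
      α.inv ≫ Ψ.functor.map (𝔉.strv (𝔉.autBaseIsoAB.symm g)).hom ≫ α.hom ≫ e.hom =
        e.hom ≫ (𝔉.strv (𝔉.autBaseIsoAB.symm (θ g))).hom)
    (hYdd : 𝔉.HB.map θ.toMonoidHom = 𝔉.HB) (h : 𝔉.HB) :
    𝔉.sgpCup h * (Dc⁻¹ * Dp) * (𝔉.sgpCup h)⁻¹ * (Dc⁻¹ * Dp)⁻¹ ∈ 𝔉.muTorsion 𝔉.BN 𝔉.N := by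
  have hm : θ.symm (h : Aut (𝔉.base.obj 𝔉.BN)) ∈ 𝔉.HB :=
    (mem_iff_of_map_equiv_eq (map_symm_eq_of_map_equiv_eq hYdd) _).mpr h.2
  have key := kummerCocycle_theta_mem_muTorsion Ψ α β e Dc Dp θ hcap hcup hdiff hU hT hT' hstrv hYdd
    ⟨θ.symm h, hm⟩
  have hθ : (⟨θ ((⟨θ.symm (h : Aut (𝔉.base.obj 𝔉.BN)), hm⟩ : 𝔉.HB) : Aut (𝔉.base.obj 𝔉.BN)),
      (mem_iff_of_map_equiv_eq hYdd _).mpr hm⟩ : 𝔉.HB) = h :=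
    Subtype.ext (θ.apply_symm_apply (h : Aut (𝔉.base.obj 𝔉.BN)))
  rw [← hθ]
  exact key

/-- The same cocycle through `s^⊓-gp_N`: for `u ∈ O^×(B_N)` and `h ∈ H_{B_N}`,
`s^⊓-gp_N(h) · u · s^⊓-gp_N(h)⁻¹ · u⁻¹ = s^⊔-gp_N(h) · u · s^⊔-gp_N(h)⁻¹ · u⁻¹` — the two sections differ by the
element `s^⊔-gp_N(h) · s^⊓-gp_N(h)⁻¹ ∈ μ_N(B_N) ⊆ O^×(B_N)` (Prop. 4.3 (iii)), which commutes with the unit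
`s^⊔-gp_N(h) · u · s^⊔-gp_N(h)⁻¹` (`O^×(B_N)` abelian, [FrdI] Rmk. 1.3.1, and normal in `Aut_C(B_N)`).
[cite: MochizukiEtTh2009, Prop 4.3 (iii) p.317 (PDF p.91); Lem 5.8 proof p.331 (PDF p.105)] -/
theorem kummerCocycleCap_eq_kummerCocycleCup (hdiff : 𝔉.BiKummerDifferenceMem) {u : Aut 𝔉.BN}
    (hu : u ∈ 𝔉.units 𝔉.BN) (h : 𝔉.HB) :
    𝔉.sgpCap (h : Aut (𝔉.base.obj 𝔉.BN)) * u * (𝔉.sgpCap (h : Aut (𝔉.base.obj 𝔉.BN)))⁻¹ * u⁻¹ =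
      𝔉.sgpCup h * u * (𝔉.sgpCup h)⁻¹ * u⁻¹ := by
  set d := 𝔉.sgpCup h * (𝔉.sgpCap (h : Aut (𝔉.base.obj 𝔉.BN)))⁻¹ with hd_def
  set v := 𝔉.sgpCup h * u * (𝔉.sgpCup h)⁻¹ with hv_def
  have hd : d ∈ 𝔉.units 𝔉.BN := 𝔉.muTorsion_le_units 𝔉.BN 𝔉.N (hdiff h)
  have hv : v ∈ 𝔉.units 𝔉.BN := (𝔉.units_normal 𝔉.BN).conj_mem u hu _
  have hc : d⁻¹ * v = v * d⁻¹ := setLike_mul_comm (s := 𝔉.units 𝔉.BN) (inv_mem hd) hv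
  calc 𝔉.sgpCap (h : Aut (𝔉.base.obj 𝔉.BN)) * u * (𝔉.sgpCap (h : Aut (𝔉.base.obj 𝔉.BN)))⁻¹ * u⁻¹
      = d⁻¹ * v * d * u⁻¹ := by rw [hd_def, hv_def]; group
    _ = v * d⁻¹ * d * u⁻¹ := by rw [hc]
    _ = v * u⁻¹ := by rw [inv_mul_cancel_right]

/-- Hence, under the transport hypotheses, also `s^⊓-gp_N(h) · u · s^⊓-gp_N(h)⁻¹ · u⁻¹ ∈ μ_N(B_N)` for all
`h ∈ H_{B_N}` (`u := D_c⁻¹ · D_p`).  [cite: MochizukiEtTh2009, Thm 5.7 p.330 (PDF p.104); Lem 5.8 proof p.331 (PDF p.105)] -/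
theorem kummerCocycleCap_mem_muTorsion_of_transport [Epi 𝔉.sCap] [Epi 𝔉.sCup] (hcap : 𝔉.SgpCapSpec)
    (hcup : 𝔉.SgpCupSpec) (hdiff : 𝔉.BiKummerDifferenceMem)
    (hU : (𝔉.units 𝔉.BN).map (𝔉.psiAut Ψ β) = 𝔉.units 𝔉.BN)
    (hT : α.inv ≫ Ψ.functor.map 𝔉.sCap ≫ β.hom = e.hom ≫ 𝔉.sCap ≫ Dc.hom)
    (hT' : α.inv ≫ Ψ.functor.map 𝔉.sCup ≫ β.hom = e.hom ≫ 𝔉.sCup ≫ Dp.hom)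
    (hstrv : ∀ g : Aut (𝔉.base.obj 𝔉.BN),
      α.inv ≫ Ψ.functor.map (𝔉.strv (𝔉.autBaseIsoAB.symm g)).hom ≫ α.hom ≫ e.hom =
        e.hom ≫ (𝔉.strv (𝔉.autBaseIsoAB.symm (θ g))).hom)
    (hYdd : 𝔉.HB.map θ.toMonoidHom = 𝔉.HB) (hu : Dc⁻¹ * Dp ∈ 𝔉.units 𝔉.BN) (h : 𝔉.HB) :
    𝔉.sgpCap (h : Aut (𝔉.base.obj 𝔉.BN)) * (Dc⁻¹ * Dp) * (𝔉.sgpCap (h : Aut (𝔉.base.obj 𝔉.BN)))⁻¹ *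
        (Dc⁻¹ * Dp)⁻¹ ∈ 𝔉.muTorsion 𝔉.BN 𝔉.N := by
  rw [kummerCocycleCap_eq_kummerCocycleCup hdiff hu h]
  exact kummerCocycle_mem_muTorsion_of_transport Ψ α β e Dc Dp θ hcap hcup hdiff hU hT hT' hstrv hYdd h

end KummerCocycle

/-! ### (2) Lemma 5.8 by name: a unit on which `H_{B_N}` acts through `μ_N(B_N)` lies in `(O_K^×)^{1/N}` -/

/-- **Lemma 5.8 for `H_{B_N}`.**  Lemma 5.8's arithmetic step (abc-iut-L2-t4's `ConstantsActByCyclotome`, BY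
NAME: `u ∈ (O_K^×)^{1/N}` iff `Π^tp_Y` acts on `u` through `μ_N(B_N)`) is stated over `Im(Π^tp_Y̲)`; print's gloss
"`Π^tp_Y` [i.e., `G_K`, via the natural surjection `Π^tp_Y ↠ G_K`] acts" (p.331 (PDF p.105)) says the action on the
constants `O^×(B_N)` factors through `G_K` — onto which `Π^tp_Ÿ̲` surjects as well (`Ÿ` geometrically connected over
`K = K̈`, §5 p.322 (PDF p.96)).  That factorisation is the hypothesis `hfac` (every `y ∈ Im(Π^tp_Y̲)` acts on
`O^×(B_N)` like some `h ∈ H_{B_N} = Im(Π^tp_Ÿ̲)`; the action through the lift `s^⊓-gp_N` is lift-independent,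
`O^×(B_N)` being abelian); with it, acting through `μ_N(B_N)` on `H_{B_N}` forces `u ∈ (O_K^×)^{1/N}`.
[cite: MochizukiEtTh2009, Lem 5.8 p.331 (PDF p.105); §5 p.322 (PDF p.96)] -/
theorem mem_OKxRootN_of_actsByCyclotome_HB (h58 : 𝔉.ConstantsActByCyclotome)
    (hfac : ∀ y ∈ 𝔉.imPiY, ∃ h ∈ 𝔉.HB, ∀ u ∈ 𝔉.units 𝔉.BN,
      𝔉.sgpCap y * u * (𝔉.sgpCap y)⁻¹ = 𝔉.sgpCap h * u * (𝔉.sgpCap h)⁻¹)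
    {u : Aut 𝔉.BN} (hu : u ∈ 𝔉.units 𝔉.BN)
    (hH : ∀ h : 𝔉.HB, 𝔉.sgpCap (h : Aut (𝔉.base.obj 𝔉.BN)) * u *
      (𝔉.sgpCap (h : Aut (𝔉.base.obj 𝔉.BN)))⁻¹ * u⁻¹ ∈ 𝔉.muTorsion 𝔉.BN 𝔉.N) :
    u ∈ 𝔉.OKxRootN := by
  refine (h58 u).mpr ⟨hu, fun y hy => ?_⟩
  obtain ⟨h, hh, hyh⟩ := hfac y hy
  rw [hyh u hu]
  exact hH ⟨h, hh⟩

section Discrepancy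

variable (Ψ : C ≌ C) (α : Ψ.functor.obj 𝔉.AN ≅ 𝔉.AN) (β : Ψ.functor.obj 𝔉.BN ≅ 𝔉.BN) (e : 𝔉.AN ≅ 𝔉.AN)
  (Dc Dp : Aut 𝔉.BN) (θ : Aut (𝔉.base.obj 𝔉.BN) ≃* Aut (𝔉.base.obj 𝔉.BN))

/-- **The unit discrepancy of the root transport lies in `(O_K^×)^{1/N}`** — the `(O_K^×)^{1/N}`-half of Theorem
5.7's rigidity clause at level `N`, DISCHARGED: from the root transport (`hT`, `hT'`, `u := D_c⁻¹·D_p ∈ O^×(B_N)` —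
this seat's `exists_codTransport_of_div_eq`), the `s^trv_N`-transport over `θ` with `θ(H_{B_N}) = H_{B_N}` (Thm. 4.4
(iv), Prop. 2.4), the §5 relations `SgpCapSpec`/`SgpCupSpec`, Prop. 4.3 (iii) (`BiKummerDifferenceMem`),
`Ψ^Aut(O^×(B_N)) = O^×(B_N)` (Thm. 4.4 (i)), Lemma 5.8 (`ConstantsActByCyclotome`) and the factorisation `hfac` of the
Galois action on constants through `G_K`.  [cite: MochizukiEtTh2009, Thm 5.7 p.330 (PDF p.104); Lem 5.8 p.331 (PDF p.105)] -/
theorem discrepancy_mem_OKxRootN [Epi 𝔉.sCap] [Epi 𝔉.sCup] (hcap : 𝔉.SgpCapSpec) (hcup : 𝔉.SgpCupSpec)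
    (hdiff : 𝔉.BiKummerDifferenceMem) (h58 : 𝔉.ConstantsActByCyclotome)
    (hfac : ∀ y ∈ 𝔉.imPiY, ∃ h ∈ 𝔉.HB, ∀ u ∈ 𝔉.units 𝔉.BN,
      𝔉.sgpCap y * u * (𝔉.sgpCap y)⁻¹ = 𝔉.sgpCap h * u * (𝔉.sgpCap h)⁻¹)
    (hU : (𝔉.units 𝔉.BN).map (𝔉.psiAut Ψ β) = 𝔉.units 𝔉.BN)
    (hT : α.inv ≫ Ψ.functor.map 𝔉.sCap ≫ β.hom = e.hom ≫ 𝔉.sCap ≫ Dc.hom)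
    (hT' : α.inv ≫ Ψ.functor.map 𝔉.sCup ≫ β.hom = e.hom ≫ 𝔉.sCup ≫ Dp.hom)
    (hstrv : ∀ g : Aut (𝔉.base.obj 𝔉.BN),
      α.inv ≫ Ψ.functor.map (𝔉.strv (𝔉.autBaseIsoAB.symm g)).hom ≫ α.hom ≫ e.hom =
        e.hom ≫ (𝔉.strv (𝔉.autBaseIsoAB.symm (θ g))).hom)
    (hYdd : 𝔉.HB.map θ.toMonoidHom = 𝔉.HB) (hu : Dc⁻¹ * Dp ∈ 𝔉.units 𝔉.BN) :
    Dc⁻¹ * Dp ∈ 𝔉.OKxRootN :=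
  mem_OKxRootN_of_actsByCyclotome_HB h58 hfac hu
    (kummerCocycleCap_mem_muTorsion_of_transport Ψ α β e Dc Dp θ hcap hcup hdiff hU hT hT' hstrv hYdd hu)

/-- The torsion half in PRINT's wording: if `u ∈ (O_K^×)^{1/N}` — so that `u^N` is (the image of) a constant
`c ∈ K^×` — and every such constant is a `2l`-th root of unity ("up to possible multiplication by a `2l`-th root of
unity", Thm. 5.7 p.330 (PDF p.104)), then `u ∈ μ_{2l·N}(B_N)`: `u^{2l·N} = 1` (`O^×(B_N) ↪ O^×(B_N^birat)` and
`K^× ↪ O^×(B_N^birat)` are injective).  [cite: MochizukiEtTh2009, Thm 5.7 p.330 (PDF p.104); Lem 5.8 p.331 (PDF p.105)] -/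
theorem pow_eq_one_of_const_pow {u : Aut 𝔉.BN} (hu : u ∈ 𝔉.units 𝔉.BN) (hO : u ∈ 𝔉.OKxRootN)
    (hζ : ∀ c : 𝔉.Kˣ, 𝔉.unitsToBirat 𝔉.BN ⟨u, hu⟩ ^ (𝔉.N : ℕ) = 𝔉.constEmb c → c ^ (2 * 𝔉.l) = 1) :
    u ^ (2 * 𝔉.l * 𝔉.N) = 1 := by
  obtain ⟨hu', c, hc⟩ := (mem_OKxRootN_iff u).mp hO
  have hcl : c ^ (2 * 𝔉.l) = 1 := hζ c hc.symm
  have hb : 𝔉.unitsToBirat 𝔉.BN ⟨u, hu⟩ ^ (2 * 𝔉.l * (𝔉.N : ℕ)) = 1 := by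
    rw [mul_comm, pow_mul, hc.symm, ← map_pow, hcl, map_one]
  have hinj := 𝔉.unitsToBirat_injective 𝔉.BN
  have h1 : (⟨u, hu⟩ : 𝔉.units 𝔉.BN) ^ (2 * 𝔉.l * (𝔉.N : ℕ)) = 1 :=
    hinj (by rw [map_pow, hb, map_one])
  exact congrArg Subtype.val h1

/-- **`RootTransportWith` from the TORSION clause alone.**  Theorem 5.7 at the `N`-th root with witnesses
`(e, D_c, D_p)` (abc-iut-L2-t4's `RootTransportWith`, the shape Thm. 5.10 (ii) consumes) from the transport
equations, `u := D_c⁻¹·D_p ∈ O^×(B_N)`, the inputs of `discrepancy_mem_OKxRootN` (which supply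
`u ∈ (O_K^×)^{1/N}`) and ONLY the torsion half of the rigidity clause, `u^{2l·N} = 1` (`htor`); `δ₃ = 1`.
[cite: MochizukiEtTh2009, Thm 5.7 p.329–330 (PDF pp.103–104)] -/
theorem rootTransportWith_of_torsion [Epi 𝔉.sCap] [Epi 𝔉.sCup] (hcap : 𝔉.SgpCapSpec) (hcup : 𝔉.SgpCupSpec)
    (hdiff : 𝔉.BiKummerDifferenceMem) (h58 : 𝔉.ConstantsActByCyclotome)
    (hfac : ∀ y ∈ 𝔉.imPiY, ∃ h ∈ 𝔉.HB, ∀ u ∈ 𝔉.units 𝔉.BN,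
      𝔉.sgpCap y * u * (𝔉.sgpCap y)⁻¹ = 𝔉.sgpCap h * u * (𝔉.sgpCap h)⁻¹)
    (hU : (𝔉.units 𝔉.BN).map (𝔉.psiAut Ψ β) = 𝔉.units 𝔉.BN)
    (hT : α.inv ≫ Ψ.functor.map 𝔉.sCap ≫ β.hom = e.hom ≫ 𝔉.sCap ≫ Dc.hom)
    (hT' : α.inv ≫ Ψ.functor.map 𝔉.sCup ≫ β.hom = e.hom ≫ 𝔉.sCup ≫ Dp.hom)
    (hstrv : ∀ g : Aut (𝔉.base.obj 𝔉.BN),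
      α.inv ≫ Ψ.functor.map (𝔉.strv (𝔉.autBaseIsoAB.symm g)).hom ≫ α.hom ≫ e.hom =
        e.hom ≫ (𝔉.strv (𝔉.autBaseIsoAB.symm (θ g))).hom)
    (hYdd : 𝔉.HB.map θ.toMonoidHom = 𝔉.HB) (hu : Dc⁻¹ * Dp ∈ 𝔉.units 𝔉.BN)
    (htor : (Dc⁻¹ * Dp) ^ (2 * 𝔉.l * 𝔉.N) = 1) :
    𝔉.RootTransportWith Ψ α β e Dc Dp :=
  ⟨hT, hT', Dc⁻¹ * Dp,
    Subgroup.mem_inf.mpr ⟨𝔉.mem_muTorsion.mpr ⟨hu, htor⟩,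
      discrepancy_mem_OKxRootN Ψ α β e Dc Dp θ hcap hcup hdiff h58 hfac hU hT hT' hstrv hYdd hu⟩,
    1, one_mem _, (mul_one _).symm⟩

/-- **Theorem 5.7 at the `N`-th root for a GIVEN `e`, from the primitive [FrdI] inputs and the TORSION clause
alone** — `Sec5Thm57.exists_rootTransportWith_of_div_eq` with its binder `hrig` REPLACED by: the §5 facts
`SgpCapSpec`/`SgpCupSpec` (p.331), Prop. 4.3 (iii), Lemma 5.8 (by name), `Ψ^Aut(O^×(B_N)) = O^×(B_N)`, the
Thm. 4.4 (iv)/Prop. 2.4 data `θ, hstrv, hYdd`, the factorisation `hfac`, and `htor : u^{2l·N} = 1` for the resulting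
unit.  [cite: MochizukiEtTh2009, Thm 5.7 p.329–330 (PDF pp.103–104); Thm 5.6 proof p.329 (PDF p.103)] -/
theorem exists_rootTransportWith_of_torsion (hepi : ∀ ⦃X Y : C⦄ (f : X ⟶ Y), Epi f)
    (hiso : 𝔉.pre.IsOfIsotropicType)
    (hiiid : ∀ ⦃A B B' : C⦄ (φ : A ⟶ B) (φ' : A ⟶ B'), 𝔉.pre.IsCoAngularPreStep φ →
      𝔉.pre.IsCoAngularPreStep φ' → 𝔉.pre.div φ ∣ 𝔉.pre.div φ' →
        ∃ f : B ⟶ B', 𝔉.pre.IsCoAngularPreStep f ∧ φ ≫ f = φ')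
    (hpre : PreFrobenioidData.PreservesMor Ψ.functor 𝔉.IsPreStep 𝔉.IsPreStep)
    (hbe : ∀ ⦃A B : C⦄ (φ ψ : A ⟶ B), 𝔉.pre.BaseEquivalent φ ψ →
      𝔉.pre.BaseEquivalent (Ψ.functor.map φ) (Ψ.functor.map ψ))
    (hcap : 𝔉.SgpCapSpec) (hcup : 𝔉.SgpCupSpec) (hdiff : 𝔉.BiKummerDifferenceMem)
    (h58 : 𝔉.ConstantsActByCyclotome)
    (hfac : ∀ y ∈ 𝔉.imPiY, ∃ h ∈ 𝔉.HB, ∀ u ∈ 𝔉.units 𝔉.BN,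
      𝔉.sgpCap y * u * (𝔉.sgpCap y)⁻¹ = 𝔉.sgpCap h * u * (𝔉.sgpCap h)⁻¹)
    (hU : (𝔉.units 𝔉.BN).map (𝔉.psiAut Ψ β) = 𝔉.units 𝔉.BN)
    (hdivcap : 𝔉.pre.div (α.inv ≫ Ψ.functor.map 𝔉.sCap ≫ β.hom) = 𝔉.pre.div (e.hom ≫ 𝔉.sCap))
    (hdivcup : 𝔉.pre.div (α.inv ≫ Ψ.functor.map 𝔉.sCup ≫ β.hom) = 𝔉.pre.div (e.hom ≫ 𝔉.sCup))
    (hstrv : ∀ g : Aut (𝔉.base.obj 𝔉.BN),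
      α.inv ≫ Ψ.functor.map (𝔉.strv (𝔉.autBaseIsoAB.symm g)).hom ≫ α.hom ≫ e.hom =
        e.hom ≫ (𝔉.strv (𝔉.autBaseIsoAB.symm (θ g))).hom)
    (hYdd : 𝔉.HB.map θ.toMonoidHom = 𝔉.HB)
    (htor : ∀ Dc Dp : Aut 𝔉.BN,
      α.inv ≫ Ψ.functor.map 𝔉.sCap ≫ β.hom = e.hom ≫ 𝔉.sCap ≫ Dc.hom →
      α.inv ≫ Ψ.functor.map 𝔉.sCup ≫ β.hom = e.hom ≫ 𝔉.sCup ≫ Dp.hom →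
      Dc⁻¹ * Dp ∈ 𝔉.units 𝔉.BN → (Dc⁻¹ * Dp) ^ (2 * 𝔉.l * 𝔉.N) = 1) :
    ∃ Dc Dp : Aut 𝔉.BN, 𝔉.RootTransportWith Ψ α β e Dc Dp ∧ Dc⁻¹ * Dp ∈ 𝔉.units 𝔉.BN := by
  haveI := hepi 𝔉.sCap
  haveI := hepi 𝔉.sCup
  obtain ⟨Dc, Dp, hT, hT', hu⟩ :=
    exists_codTransport_of_div_eq Ψ α β hepi hiso hiiid hpre hbe e hdivcap hdivcup
  exact ⟨Dc, Dp, rootTransportWith_of_torsion Ψ α β e Dc Dp θ hcap hcup hdiff h58 hfac hU hT hT' hstrv hYdd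
    hu (htor Dc Dp hT hT' hu), hu⟩

end Discrepancy

/-! ### (3) Theorem 5.10 (ii)(iii) END-TO-END with the torsion clause as the only rigidity input -/

section EndToEnd

variable (Ψ : C ≌ C) (α : Ψ.functor.obj 𝔉.AN ≅ 𝔉.AN) (β : Ψ.functor.obj 𝔉.BN ≅ 𝔉.BN)

/-- **[EtTh] Theorem 5.10 (ii) and (iii), END-TO-END, with Theorem 5.7's rigidity entering ONLY as the torsion
clause.**  As `Sec5ModelCase.thm510_ii_iii_of_div_eq` (inputs: `C` totally epimorphic and of isotropic type, [FrdI]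
Def. 1.3 (iii)(d), "`Ψ` preserves pre-steps", abc-iut-L2-t4's §5 `Facts`, a faithful 1-compatible `Ψ^bs`, the
birational square and constants, Prop. 5.3 (vi) at `A_N` for `e`, the Thm. 4.4 (iv)/Prop. 2.4 data), but the binder
`hζ` ("`u^N` is a `2l`-th root of unity of `K`") is SPLIT: its `(O_K^×)^{1/N}`-half is now PROVED
(`discrepancy_mem_OKxRootN`, from `Facts.biKummerDifferenceMem` + `Facts.constantsActByCyclotome` + `hfac`), and only
`htor` (`u^{2l·N} = 1`) remains.  [cite: MochizukiEtTh2009, Thm 5.10 (ii)(iii) p.333–335 (PDF pp.107–109); Thm 5.7 p.330 (PDF p.104)] -/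
theorem thm510_ii_iii_of_torsion (hepi : ∀ ⦃X Y : C⦄ (f : X ⟶ Y), Epi f) (hiso : 𝔉.pre.IsOfIsotropicType)
    (hiiid : ∀ ⦃A B B' : C⦄ (φ : A ⟶ B) (φ' : A ⟶ B'), 𝔉.pre.IsCoAngularPreStep φ →
      𝔉.pre.IsCoAngularPreStep φ' → 𝔉.pre.div φ ∣ 𝔉.pre.div φ' →
        ∃ f : B ⟶ B', 𝔉.pre.IsCoAngularPreStep f ∧ φ ≫ f = φ')
    (hpre : PreFrobenioidData.PreservesMor Ψ.functor 𝔉.IsPreStep 𝔉.IsPreStep) (H : 𝔉.Facts)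
    (hfac : ∀ y ∈ 𝔉.imPiY, ∃ h ∈ 𝔉.HB, ∀ u ∈ 𝔉.units 𝔉.BN,
      𝔉.sgpCap y * u * (𝔉.sgpCap y)⁻¹ = 𝔉.sgpCap h * u * (𝔉.sgpCap h)⁻¹)
    (ΨbiratAut : 𝔉.biratUnits 𝔉.BN ≃* 𝔉.biratUnits 𝔉.BN)
    (Ψbs : D ⥤ D) [Ψbs.Faithful] (eΨ : Ψ.functor ⋙ 𝔉.base ≅ 𝔉.base ⋙ Ψbs)
    (hsq : ∀ u : 𝔉.units 𝔉.BN, ∀ hu : 𝔉.psiAut Ψ β u ∈ 𝔉.units 𝔉.BN,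
      ΨbiratAut (𝔉.unitsToBirat 𝔉.BN u) = 𝔉.unitsToBirat 𝔉.BN ⟨_, hu⟩)
    (hconst : 𝔉.constEmb.range.map ΨbiratAut.toMonoidHom = 𝔉.constEmb.range)
    (e : 𝔉.AN ≅ 𝔉.AN)
    (hcap : 𝔉.pre.div (α.inv ≫ Ψ.functor.map 𝔉.sCap ≫ β.hom) = 𝔉.pre.div (e.hom ≫ 𝔉.sCap))
    (hcup : 𝔉.pre.div (α.inv ≫ Ψ.functor.map 𝔉.sCup ≫ β.hom) = 𝔉.pre.div (e.hom ≫ 𝔉.sCup))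
    (htor : ∀ Dc Dp : Aut 𝔉.BN,
      α.inv ≫ Ψ.functor.map 𝔉.sCap ≫ β.hom = e.hom ≫ 𝔉.sCap ≫ Dc.hom →
      α.inv ≫ Ψ.functor.map 𝔉.sCup ≫ β.hom = e.hom ≫ 𝔉.sCup ≫ Dp.hom →
      Dc⁻¹ * Dp ∈ 𝔉.units 𝔉.BN → (Dc⁻¹ * Dp) ^ (2 * 𝔉.l * 𝔉.N) = 1)
    (θ : Aut (𝔉.base.obj 𝔉.BN) ≃* Aut (𝔉.base.obj 𝔉.BN))
    (hstrv : ∀ g : Aut (𝔉.base.obj 𝔉.BN),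
      α.inv ≫ Ψ.functor.map (𝔉.strv (𝔉.autBaseIsoAB.symm g)).hom ≫ α.hom ≫ e.hom =
        e.hom ≫ (𝔉.strv (𝔉.autBaseIsoAB.symm (θ g))).hom)
    (hY : 𝔉.imPiY.map θ.toMonoidHom = 𝔉.imPiY) (hYdd : 𝔉.HB.map θ.toMonoidHom = 𝔉.HB)
    (ψY : 𝔉.PiX ≃ₜ* 𝔉.PiX)
    (hbase : ∀ g, 𝔉.autBase 𝔉.BN (𝔉.psiAut Ψ β (𝔉.sgpCap (𝔉.ρ g))) = 𝔉.ρ (ψY g))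
    (hψY : 𝔉.PiY.map ψY.toMulEquiv.toMonoidHom = 𝔉.PiY)
    (hψYdd : 𝔉.PiYdd.map ψY.toMulEquiv.toMonoidHom = 𝔉.PiYdd) :
    𝔉.PsiAutPreserves Ψ β ΨbiratAut ∧
      𝔉.MonoThetaEnvCompat H.sectionsFactor 𝔉.outerActionLZ_of H.sgpCapSection H.sgpCupSection
        H.constantsEqNormalizer ∅ Ψ β ψY hbase hψY hψYdd := by
  haveI := H.epi_sCap
  haveI := H.epi_sCup
  obtain ⟨Dc, Dp, hRT, -⟩ := exists_rootTransportWith_of_torsion Ψ α β e θ hepi hiso hiiid hpre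
    (fun _ _ φ ψ hb => baseEquivalent_map_of_compat Ψ Ψbs eΨ hb) H.sgpCapSpec H.sgpCupSpec
    H.biKummerDifferenceMem H.constantsActByCyclotome hfac (units_map_psiAut Ψ β Ψbs eΨ) hcap hcup hstrv hYdd
    htor
  exact H.thm510_ii_iii_of_rootTransportWith Ψ β ΨbiratAut Ψbs eΨ hsq hconst α e Dc Dp hRT θ hstrv hY hYdd ψY
    hbase hψY hψYdd

end EndToEnd

end ThetaFrobenioid

/-! ### (3′) The tower: Theorem 5.7 at ALL levels with the torsion clause as the only per-level rigidity input -/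

namespace ThetaFrobenioidTower

variable {C : Type u} [Category.{v} C] {D : Type u'} [Category.{v'} D] (𝔗 : ThetaFrobenioidTower.{w} C D)
  (Ψ : C ≌ C)

/-- **[EtTh] Theorem 5.7 (root level) at ALL levels — `ThetaRootPreservedAll Ψ` — modulo the printed inputs, with
the rigidity clause reduced to its TORSION half at every level.**  As `thetaRootPreservedAll_of`, but `hrig` is
replaced by: the level-wise §5 facts (`SgpCapSpec`, `SgpCupSpec`, Prop. 4.3 (iii), Lemma 5.8 — abc-iut-L2-t4's
names, read at `𝔗.atLevel N`), `Ψ^Aut(O^×(B_N)) = O^×(B_N)`, the Thm. 4.4 (iv)/Prop. 2.4 transport data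
(`θ`, `hstrv`, `hYdd`, for the `e` of the divisor matching `hdiv`), the factorisation `hfac`, and `htor`.
[cite: MochizukiEtTh2009, Thm 5.7 p.329–330 (PDF pp.103–104); Rmk 4.3.2 p.319 (PDF p.93); Lem 5.8 p.331 (PDF p.105)] -/
theorem thetaRootPreservedAll_of_torsion (hepi : ∀ ⦃X Y : C⦄ (f : X ⟶ Y), Epi f)
    (hiso : 𝔗.pre.IsOfIsotropicType)
    (hiiid : ∀ ⦃A B B' : C⦄ (φ : A ⟶ B) (φ' : A ⟶ B'), 𝔗.pre.IsCoAngularPreStep φ →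
      𝔗.pre.IsCoAngularPreStep φ' → 𝔗.pre.div φ ∣ 𝔗.pre.div φ' →
        ∃ f : B ⟶ B', 𝔗.pre.IsCoAngularPreStep f ∧ φ ≫ f = φ')
    (hpre : PreFrobenioidData.PreservesMor Ψ.functor 𝔗.pre.IsPreStep 𝔗.pre.IsPreStep)
    (hbe : ∀ ⦃A B : C⦄ (φ ψ : A ⟶ B), 𝔗.pre.BaseEquivalent φ ψ →
      𝔗.pre.BaseEquivalent (Ψ.functor.map φ) (Ψ.functor.map ψ))
    (hcap : ∀ N, (𝔗.atLevel N).SgpCapSpec) (hcup : ∀ N, (𝔗.atLevel N).SgpCupSpec)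
    (hdiff : ∀ N, (𝔗.atLevel N).BiKummerDifferenceMem) (h58 : ∀ N, (𝔗.atLevel N).ConstantsActByCyclotome)
    (hfac : ∀ N, ∀ y ∈ (𝔗.atLevel N).imPiY, ∃ h ∈ (𝔗.atLevel N).HB, ∀ u ∈ (𝔗.atLevel N).units (𝔗.BN N),
      𝔗.sgpCap N y * u * (𝔗.sgpCap N y)⁻¹ = 𝔗.sgpCap N h * u * (𝔗.sgpCap N h)⁻¹)
    (hU : ∀ (N) (β : Ψ.functor.obj (𝔗.BN N) ≅ 𝔗.BN N),
      ((𝔗.atLevel N).units (𝔗.BN N)).map ((𝔗.atLevel N).psiAut Ψ β) = (𝔗.atLevel N).units (𝔗.BN N))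
    (hdiv : ∀ (N : ℕ+) (α : Ψ.functor.obj (𝔗.AN N) ≅ 𝔗.AN N) (β : Ψ.functor.obj (𝔗.BN N) ≅ 𝔗.BN N),
      ∃ (e : 𝔗.AN N ≅ 𝔗.AN N) (θ : Aut (𝔗.pre.base.obj (𝔗.BN N)) ≃* Aut (𝔗.pre.base.obj (𝔗.BN N))),
        𝔗.pre.div (α.inv ≫ Ψ.functor.map (𝔗.sCap N) ≫ β.hom) = 𝔗.pre.div (e.hom ≫ 𝔗.sCap N) ∧
        𝔗.pre.div (α.inv ≫ Ψ.functor.map (𝔗.sCup N) ≫ β.hom) = 𝔗.pre.div (e.hom ≫ 𝔗.sCup N) ∧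
        (𝔗.atLevel N).StrvTransport Ψ α e θ ∧ (𝔗.atLevel N).HB.map θ.toMonoidHom = (𝔗.atLevel N).HB)
    (htor : ∀ (N : ℕ+) (α : Ψ.functor.obj (𝔗.AN N) ≅ 𝔗.AN N) (β : Ψ.functor.obj (𝔗.BN N) ≅ 𝔗.BN N)
      (e : 𝔗.AN N ≅ 𝔗.AN N) (Dc Dp : Aut (𝔗.BN N)),
      α.inv ≫ Ψ.functor.map (𝔗.sCap N) ≫ β.hom = e.hom ≫ 𝔗.sCap N ≫ Dc.hom →
      α.inv ≫ Ψ.functor.map (𝔗.sCup N) ≫ β.hom = e.hom ≫ 𝔗.sCup N ≫ Dp.hom →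
      Dc⁻¹ * Dp ∈ (𝔗.atLevel N).units (𝔗.BN N) → (Dc⁻¹ * Dp) ^ (2 * 𝔗.l * N) = 1) :
    𝔗.ThetaRootPreservedAll Ψ := by
  intro N α β
  obtain ⟨e, θ, hdc, hdp, hstrv, hYdd⟩ := hdiv N α β
  haveI := hepi (𝔗.sCap N)
  haveI := hepi (𝔗.sCup N)
  obtain ⟨Dc, Dp, hRT, -⟩ := ThetaFrobenioid.exists_rootTransportWith_of_torsion (𝔉 := 𝔗.atLevel N) Ψ α β e θ
    hepi hiso hiiid hpre hbe (hcap N) (hcup N) (hdiff N) (h58 N) (hfac N) (hU N β) hdc hdp hstrv hYdd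
    (htor N α β e)
  exact hRT.rootTransport

end ThetaFrobenioidTower

end Literature.AnabelianGeometry.EtaleTheta
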